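import Mathlib

/-!
# Negative lemma for crux `OverlapGapAlgebra.NoStableSection` (stmt-PneNP-2462): stability is
# load-bearing, modulo near-satisfiability

Refuter (cdisprove) output, supports stmt-PneNP-2462; no statement of the route is asserted
positively (Mathlib-only imports; the variant is spelled out verbatim from the text of
`Summit.PneNP.PneNP.Theses.OverlapGapAlgebra.NoStableSection`).
`NoStableSectionWithoutConsec` is the crux with its STABILITY conjunct
(`hammingDist (g (P r q)) (g (P r (q+1))) ≤ η n`) deleted. It is FALSE provided random k-SAT at the
window density `5·2^k log k/k` is `ν`-near-satisfiable with high probability at a polynomial rate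
(`NoStableSectionNearSatWhp k` for all large `k` — in print: Achlioptas–Peres 2004 Thm 2 gives
uniformly positive satisfiability below `2^k log 2 - O(k)`, and Azuma/McDiarmid concentration of the
1-Lipschitz max-sat value upgrades it to `Pr[no ν-satisfying assignment] ≤ e^{-Ω(ν² m)}`; the tree
does not hold this, so the lemma is stated as an implication with the hypothesis spelled out).
Witness section: `g Φ :=` an assignment violating `≤ ν m` clauses when one exists. Engine: the
splice maps `Ψ ↦ P r q` of the typed path space have UNIFORM FIBRES
(`noStableSection_card_filter_splice_mem`: `#{Ψ : P r q Ψ ∈ B} = #B · #Inst^k`, via the involution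
`noStableSectionSwapAt` exchanging sweeps `r`, `r+1` below position `q`), so the paths with some
non-near-satisfiable splice-point instance are at most `k(mk+1)·#Bad·#Inst^k ≤ #paths/8`.
-/

namespace Summit.PneNP.PneNP.Cruxes.NoStableSection.Negative

set_option linter.dupNamespace false

open Finset Real Filter

section Fiber

variable {k m n : ℕ}

/-- Swap, at the literal positions `a·k+b < q`, the entries of sweeps `r` and `r+1` of a path. -/
def noStableSectionSwapAt (r : Fin k) (q : ℕ) (Ψ : Fin (k + 1) → Fin m → Fin k → Fin n × Bool) :
    Fin (k + 1) → Fin m → Fin k → Fin n × Bool :=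
  fun s a b => if (a : ℕ) * k + b < q then
      (if s = r.castSucc then Ψ r.succ a b else if s = r.succ then Ψ r.castSucc a b else Ψ s a b)
    else Ψ s a b

/-- `noStableSectionSwapAt r q` is an involution. -/
theorem noStableSectionSwapAt_swapAt (r : Fin k) (q : ℕ) (Ψ : Fin (k + 1) → Fin m → Fin k → Fin n × Bool) :
    noStableSectionSwapAt r q (noStableSectionSwapAt r q Ψ) = Ψ := by
  have hne : r.castSucc ≠ r.succ := ne_of_lt Fin.castSucc_lt_succ
  funext s a b
  by_cases h : (a : ℕ) * k + b < q
  · by_cases h1 : s = r.castSucc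
    · subst h1
      simp [noStableSectionSwapAt, h, hne.symm]
    · by_cases h2 : s = r.succ
      · subst h2
        simp [noStableSectionSwapAt, h, hne.symm]
      · simp [noStableSectionSwapAt, h, h1, h2]
  · simp [noStableSectionSwapAt, h]

/-- Sweep `r` of the swapped path is the splice point `(r, q)` of the original path. -/
theorem noStableSectionSwapAt_castSucc (r : Fin k) (q : ℕ) (Ψ : Fin (k + 1) → Fin m → Fin k → Fin n × Bool) :
    noStableSectionSwapAt r q Ψ r.castSucc =
      fun (a : Fin m) (b : Fin k) => if (a : ℕ) * k + b < q then Ψ r.succ a b else Ψ r.castSucc a b := by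
  funext a b
  by_cases h : (a : ℕ) * k + b < q <;> simp [noStableSectionSwapAt, h]

/-- `noStableSectionSwapAt r q` as an involutive permutation of the path space. -/
def noStableSectionSwapEquiv (r : Fin k) (q : ℕ) :
    (Fin (k + 1) → Fin m → Fin k → Fin n × Bool) ≃ (Fin (k + 1) → Fin m → Fin k → Fin n × Bool) where
  toFun := noStableSectionSwapAt r q
  invFun := noStableSectionSwapAt r q
  left_inv := noStableSectionSwapAt_swapAt r q
  right_inv := noStableSectionSwapAt_swapAt r q

/-- Fibres of a coordinate projection of the path space are uniform. -/
theorem noStableSection_card_filter_apply_mem (r₀ : Fin (k + 1)) (B : Finset (Fin m → Fin k → Fin n × Bool)) :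
    ((Finset.univ.filter fun Ψ : Fin (k + 1) → Fin m → Fin k → Fin n × Bool => Ψ r₀ ∈ B).card) =
      B.card * (Fintype.card (Fin m → Fin k → Fin n × Bool)) ^ k := by
  classical
  let e := (Fin.insertNthEquiv (fun _ : Fin (k + 1) => Fin m → Fin k → Fin n × Bool) r₀).symm
  rw [Finset.card_equiv e (t := B ×ˢ (Finset.univ : Finset (Fin k → Fin m → Fin k → Fin n × Bool)))]
  · rw [Finset.card_product, Finset.card_univ, Fintype.card_fun, Fintype.card_fin]
  · intro Ψ
    simp [e]

/-- Fibres of the splice map `Ψ ↦ P r q` are uniform: `#{Ψ : P r q ∈ B} = #B · #Inst^k`. -/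
theorem noStableSection_card_filter_splice_mem (r : Fin k) (q : ℕ) (B : Finset (Fin m → Fin k → Fin n × Bool)) :
    ((Finset.univ.filter fun Ψ : Fin (k + 1) → Fin m → Fin k → Fin n × Bool =>
        (fun (a : Fin m) (b : Fin k) => if (a : ℕ) * k + b < q then Ψ r.succ a b else Ψ r.castSucc a b) ∈ B).card) =
      B.card * (Fintype.card (Fin m → Fin k → Fin n × Bool)) ^ k := by
  rw [← noStableSection_card_filter_apply_mem r.castSucc B]
  refine Finset.card_equiv (noStableSectionSwapEquiv r q) (fun Ψ => ?_)
  simp only [Finset.mem_filter, Finset.mem_univ, true_and]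
  change _ ↔ noStableSectionSwapAt r q Ψ r.castSucc ∈ B
  rw [noStableSectionSwapAt_castSucc]

end Fiber

section WithoutConsec

/-- The crux with the STABILITY conjunct `∀ r, ∀ q < m k, hammingDist ≤ η n` deleted (only
`ν`-validity at every splice point is kept). -/
def NoStableSectionWithoutConsec : Prop :=
  ∃ k₀ : ℕ, ∀ k ≥ k₀, ∃ ν : ℝ, 0 < ν ∧ ∃ c : ℝ, 0 < c ∧ ∀ᶠ n : ℕ in Filter.atTop, ∀ m : ℕ,
    m = ⌊5 * 2 ^ k * Real.log k / k * n⌋₊ →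
    ∀ g : (Fin m → Fin k → Fin n × Bool) → (Fin n → Bool),
      ((Finset.univ.filter fun Ψ : Fin (k + 1) → Fin m → Fin k → Fin n × Bool =>
        let P : Fin k → ℕ → Fin m → Fin k → Fin n × Bool := fun r q a b =>
          if (a : ℕ) * k + b < q then Ψ r.succ a b else Ψ r.castSucc a b
        ∀ r : Fin k, ∀ q ≤ m * k, ((Finset.univ.filter fun i : Fin m =>
          ∀ j, g (P r q) (P r q i j).1 ≠ (P r q i j).2).card : ℝ) ≤ ν * m).card : ℝ)
      ≤ Real.exp (-(c * n)) * Fintype.card (Fin (k + 1) → Fin m → Fin k → Fin n × Bool)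

/-- **Hypothesis `NoStableSectionNearSatWhp k`** (near-satisfiability with high probability at the window density,
with a polynomial rate; a theorem in print — Achlioptas–Peres 2004 Thm 2 gives `Pr[sat] ≥ c_k > 0`
uniformly at density `5·2^k log k/k < 2^k log 2 - O(k)`, and Azuma/McDiarmid concentration of the
1-Lipschitz max-sat value then gives `Pr[no ν-satisfying assignment] ≤ e^{-Ω(ν² m)}` — but NOT in
the tree): for every `ν > 0`, eventually the instances `Φ : Fin m → Fin k → Fin n × Bool` admitting NO
assignment violating at most `ν m` clauses are at most a `1/(8·k·(m k + 1))` fraction. -/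
def NoStableSectionNearSatWhp (k : ℕ) : Prop :=
  ∀ ν : ℝ, 0 < ν → ∀ᶠ n : ℕ in Filter.atTop, ∀ m : ℕ, m = ⌊5 * 2 ^ k * Real.log k / k * n⌋₊ →
    (8 * k * (m * k + 1) : ℝ) * ((Finset.univ.filter fun Φ : Fin m → Fin k → Fin n × Bool =>
        ∀ σ : Fin n → Bool, ν * m < ((Finset.univ.filter fun i : Fin m =>
          ∀ j, σ (Φ i j).1 ≠ (Φ i j).2).card : ℝ)).card : ℝ)
      ≤ Fintype.card (Fin m → Fin k → Fin n × Bool)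

/-- **Stability is load-bearing (modulo near-satisfiability)**: if `NoStableSectionNearSatWhp k` holds for all
large `k`, then the crux with the stability conjunct deleted is FALSE. Witness: the section
`g Φ :=` some assignment violating `≤ ν m` clauses of `Φ` when one exists. Its event contains every
path all of whose `k(mk+1)` splice-point instances are `ν`-satisfiable; each splice map
`Ψ ↦ P r q` has uniform fibres (`noStableSection_card_filter_splice_mem`), so by the union bound the complement is
at most `k(mk+1) · #Bad · #Inst^k ≤ #paths/8`, whence `#event ≥ (7/8) #paths > e^{-cn} #paths` as
soon as `c n > log 2`. -/
theorem noStableSection_false_without_consec_of_nearSat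
    (H : ∃ k₁ : ℕ, ∀ k ≥ k₁, NoStableSectionNearSatWhp k) :
    ¬ NoStableSectionWithoutConsec := by
  classical
  rintro ⟨k₀, h⟩
  obtain ⟨k₁, hH⟩ := H
  set k : ℕ := max k₀ k₁ with hkdef
  obtain ⟨ν, hν, c, hc, hev⟩ := h k (le_max_left _ _)
  have hnear := hH k (le_max_right _ _) ν hν
  have hlog : ∀ᶠ n : ℕ in Filter.atTop, Real.log 2 < c * (n : ℝ) :=
    ((tendsto_natCast_atTop_atTop (R := ℝ)).const_mul_atTop hc).eventually_gt_atTop _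
  obtain ⟨n, hlogn, hevn, hnearn⟩ := (hlog.and (hev.and hnear)).exists
  set α : ℝ := 5 * 2 ^ k * Real.log k / k with hα
  set m : ℕ := ⌊α * n⌋₊ with hm
  -- abbreviations
  set X := (Fin m → Fin k → Fin n × Bool) with hX
  let viol : (Fin n → Bool) → X → ℕ := fun σ Φ =>
    (Finset.univ.filter fun i : Fin m => ∀ j, σ (Φ i j).1 ≠ (Φ i j).2).card
  let sp : (Fin (k + 1) → X) → Fin k → ℕ → X := fun Ψ r q a b =>
    if (a : ℕ) * k + b < q then Ψ r.succ a b else Ψ r.castSucc a b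
  -- the witness section
  let g : X → (Fin n → Bool) := fun Φ =>
    if hΦ : ∃ σ : Fin n → Bool, (viol σ Φ : ℝ) ≤ ν * m then hΦ.choose else fun _ => false
  have hmain := hevn m (by rw [hm, hα]) g
  have hnear' := hnearn m (by rw [hm, hα])
  -- good paths: every splice-point instance is ν-satisfiable
  set Good : Finset (Fin (k + 1) → X) := Finset.univ.filter fun Ψ =>
    ∀ r : Fin k, ∀ q ≤ m * k, ∃ σ : Fin n → Bool, (viol σ (sp Ψ r q) : ℝ) ≤ ν * m with hGood
  set Bad : Finset X := Finset.univ.filter fun Φ => ∀ σ : Fin n → Bool, ν * m < (viol σ Φ : ℝ)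
    with hBad
  set Ev : Finset (Fin (k + 1) → X) := Finset.univ.filter fun Ψ =>
    ∀ r : Fin k, ∀ q ≤ m * k, (viol (g (sp Ψ r q)) (sp Ψ r q) : ℝ) ≤ ν * m with hEv
  -- (1) Good ⊆ event of g
  have h1 : Good ⊆ Ev := by
    intro Ψ hΨ
    rw [hGood, Finset.mem_filter] at hΨ
    rw [hEv, Finset.mem_filter]
    refine ⟨Finset.mem_univ _, fun r q hq => ?_⟩
    have hex := hΨ.2 r q hq
    have hg : g (sp Ψ r q) = hex.choose := by simp only [g, dif_pos hex]
    rw [hg]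
    exact hex.choose_spec
  -- (2) the complement of Good is covered by the bad fibres
  have h2 : (Finset.univ.filter fun Ψ : Fin (k + 1) → X => ¬ (∀ r : Fin k, ∀ q ≤ m * k,
      ∃ σ : Fin n → Bool, (viol σ (sp Ψ r q) : ℝ) ≤ ν * m)) ⊆
      (Finset.univ : Finset (Fin k)).biUnion fun r => (Finset.range (m * k + 1)).biUnion fun q =>
        Finset.univ.filter fun Ψ : Fin (k + 1) → X => sp Ψ r q ∈ Bad := by
    intro Ψ hΨ
    rw [Finset.mem_filter] at hΨ
    obtain ⟨r, q, hq, hbad⟩ : ∃ r : Fin k, ∃ q, q ≤ m * k ∧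
        ¬ ∃ σ : Fin n → Bool, (viol σ (sp Ψ r q) : ℝ) ≤ ν * m := by
      by_contra hcon
      apply hΨ.2
      intro r q hq
      by_contra hno
      exact hcon ⟨r, q, hq, hno⟩
    simp only [Finset.mem_biUnion, Finset.mem_univ, true_and, Finset.mem_range, Finset.mem_filter]
    refine ⟨r, q, Nat.lt_succ_of_le hq, ?_⟩
    rw [hBad, Finset.mem_filter]
    refine ⟨Finset.mem_univ _, fun σ => ?_⟩
    by_contra hle
    exact hbad ⟨σ, not_lt.1 hle⟩
  -- (3) counting
  have hcardX : (Fintype.card (Fin (k + 1) → X) : ℝ) = (Fintype.card X : ℝ) ^ (k + 1) := by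
    rw [Fintype.card_fun, Fintype.card_fin]; push_cast; ring
  have hfib : ∀ (r : Fin k) (q : ℕ), ((Finset.univ.filter fun Ψ : Fin (k + 1) → X =>
      sp Ψ r q ∈ Bad).card : ℝ) = (Bad.card : ℝ) * (Fintype.card X : ℝ) ^ k := by
    intro r q
    exact_mod_cast noStableSection_card_filter_splice_mem r q Bad
  have hcompl : ((Finset.univ.filter fun Ψ : Fin (k + 1) → X => ¬ (∀ r : Fin k, ∀ q ≤ m * k,
      ∃ σ : Fin n → Bool, (viol σ (sp Ψ r q) : ℝ) ≤ ν * m)).card : ℝ) ≤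
      (k * (m * k + 1) : ℝ) * ((Bad.card : ℝ) * (Fintype.card X : ℝ) ^ k) := by
    calc ((Finset.univ.filter fun Ψ : Fin (k + 1) → X => ¬ (∀ r : Fin k, ∀ q ≤ m * k,
            ∃ σ : Fin n → Bool, (viol σ (sp Ψ r q) : ℝ) ≤ ν * m)).card : ℝ)
        ≤ (((Finset.univ : Finset (Fin k)).biUnion fun r => (Finset.range (m * k + 1)).biUnion
            fun q => Finset.univ.filter fun Ψ : Fin (k + 1) → X => sp Ψ r q ∈ Bad).card : ℝ) := by
          exact_mod_cast Finset.card_le_card h2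
      _ ≤ ∑ r : Fin k, (((Finset.range (m * k + 1)).biUnion
            fun q => Finset.univ.filter fun Ψ : Fin (k + 1) → X => sp Ψ r q ∈ Bad).card : ℝ) := by
          exact_mod_cast Finset.card_biUnion_le
      _ ≤ ∑ r : Fin k, ∑ q ∈ Finset.range (m * k + 1),
            ((Finset.univ.filter fun Ψ : Fin (k + 1) → X => sp Ψ r q ∈ Bad).card : ℝ) := by
          refine Finset.sum_le_sum fun r _ => ?_
          exact_mod_cast Finset.card_biUnion_le
      _ = (k * (m * k + 1) : ℝ) * ((Bad.card : ℝ) * (Fintype.card X : ℝ) ^ k) := by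
          simp only [hfib, Finset.sum_const, Finset.card_range, Finset.card_univ, Fintype.card_fin,
            nsmul_eq_mul]
          push_cast
          ring
  have hsplit : (Good.card : ℝ) + ((Finset.univ.filter fun Ψ : Fin (k + 1) → X =>
      ¬ (∀ r : Fin k, ∀ q ≤ m * k, ∃ σ : Fin n → Bool, (viol σ (sp Ψ r q) : ℝ) ≤ ν * m)).card : ℝ)
      = Fintype.card (Fin (k + 1) → X) := by
    rw [hGood]
    exact_mod_cast Finset.card_filter_add_card_filter_not _
  have hEv_le : (Ev.card : ℝ) ≤ Real.exp (-(c * n)) * Fintype.card (Fin (k + 1) → X) := hmain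
  have hGood_le : (Good.card : ℝ) ≤ Ev.card := by exact_mod_cast Finset.card_le_card h1
  -- e^{-cn} < 1/2 and #paths > 0
  have hexp : Real.exp (-(c * n)) < 1 / 2 := by
    have h2 : Real.exp (-Real.log 2) = 1 / 2 := by
      rw [Real.exp_neg, Real.exp_log (by norm_num : (0 : ℝ) < 2), one_div]
    have : Real.exp (-(c * n)) < Real.exp (-Real.log 2) := Real.exp_lt_exp.2 (by linarith)
    rwa [h2] at this
  have hn0 : 0 < n := by
    rcases Nat.eq_zero_or_pos n with h0 | hpos
    · exfalso
      rw [h0, Nat.cast_zero, mul_zero] at hlogn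
      linarith [Real.log_pos (by norm_num : (1 : ℝ) < 2)]
    · exact hpos
  haveI : Nonempty (Fin n) := ⟨⟨0, hn0⟩⟩
  have hXpos : (0 : ℝ) < Fintype.card X := by exact_mod_cast Fintype.card_pos
  have hPpos : (0 : ℝ) < Fintype.card (Fin (k + 1) → X) := by exact_mod_cast Fintype.card_pos
  -- near-satisfiability: 8 k (mk+1) #Bad ≤ #X
  have hB : (8 * k * (m * k + 1) : ℝ) * (Bad.card : ℝ) ≤ Fintype.card X := hnear'
  -- assemble
  have hkey : (k * (m * k + 1) : ℝ) * ((Bad.card : ℝ) * (Fintype.card X : ℝ) ^ k) ≤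
      (Fintype.card (Fin (k + 1) → X) : ℝ) / 8 := by
    rw [hcardX, pow_succ]
    have hXk : (0 : ℝ) ≤ (Fintype.card X : ℝ) ^ k := by positivity
    calc (k * (m * k + 1) : ℝ) * ((Bad.card : ℝ) * (Fintype.card X : ℝ) ^ k)
        = ((8 * k * (m * k + 1) : ℝ) * (Bad.card : ℝ)) / 8 * (Fintype.card X : ℝ) ^ k := by ring
      _ ≤ (Fintype.card X : ℝ) / 8 * (Fintype.card X : ℝ) ^ k :=
          mul_le_mul_of_nonneg_right (by linarith) hXk
      _ = (Fintype.card X : ℝ) ^ k * (Fintype.card X : ℝ) / 8 := by ring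
  nlinarith

end WithoutConsec

end Summit.PneNP.PneNP.Cruxes.NoStableSection.Negative
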